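/-
Copyright (c) 2026 the pub-hodgecm-mathlib formalisation cell (harness21).  Prover seat hodgecm-mathlib-F0P2-p01 (g19) on the word of the P2 chair F0P2-ref1 (g11)
(r381, «END-GAME W1 TWIN», text of record = custody cert `F0/P2/ref1-g11/CERT-P2-endgame-v3c.F0P2-ref1-g11.lean` 5d2d4ee4b7fc8839 :135–195), 2026-09-02.
-/
import Summits.HodgeConjecture.HodgeConjecture.Theorems.F0P2vRelOneOfRelSharpOne   -- ★ p845970 twin REL¹ ⟸ REL♯¹ `relOne_of_relSharpOne`
import Summits.HodgeConjecture.HodgeConjecture.Theorems.F0P2vE3FlatOfRelOne        -- ★ p845971 twin E3♭ ⟸ REL¹ `e3flat_of_relOne`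
import Summits.HodgeConjecture.HodgeConjecture.Theorems.F0P2vPKPiOfTokensW1        -- ★ p849503 twin PKΠ ⟸ #80 + D7αᵀ-W1 `pkPi_of_tokensW1` (W1 node ★ p849450 `F0P2oD7alphaMemDockStatementW1.StubD7αMemDockPerMeasureTW1`)
import Summits.HodgeConjecture.HodgeConjecture.Theorems.F0P2kHdictEOfLetters       -- ★ p820501 `hdictE_of_PKPi_E3flat`
import Summits.HodgeConjecture.HodgeConjecture.Theorems.HCCMUnconditionalH413OfF0  -- ★ `H413_of_F0HdictE_F0HJ3a` (socket 27457 `F0Hocc` ★ inside)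
import HarnessLib

/-!
# ROAD II′ END-GAME (W1) BY NAME: `F0HdictE` and the crux `H413` from EXACTLY the three remaining print inputs #80 S2♯, D7αᵀ-W1, REL♯¹ (+ socket `F0HJ3a`)

HONEST LABEL: HC_CM is proved only modulo the 7 printed citations (2 remaining: hLiu418 = stmt-HodgeConjecture-24832, h413 = stmt-HodgeConjecture-24833) until
rung 0 closes.  Summits THEOREMS file, supports-only lane of crux H413 (stmt-HodgeConjecture-24833), cell `pub/hodgecm-mathlib`, sub-problem P2 («Θ-dictionary»);
NO new mathematics — two COMPOSITIONS of ★ report-first twins, landed so that the registrar's closing term the day the three print inputs are ★ is ONE NAME: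
`H413_of_tokensW1 h80 hD7αTW1 hRS hJ3a`.  Dedup (chair r381, `rg` over `Theorems/` 08:37Z): no Theorems file concludes `F0HdictE` ∕ `H413` from exactly these tokens.

THE CHAIN (all ★, kernel-rechecked here BY IMPORT against the tree texts):
* `hdictE_of_tokensW1 (h80) (hD7αTW1) (hRS) : HCCMUnconditional.F0HdictE :=
    F0P2kHdictEOfLetters.hdictE_of_PKPi_E3flat (F0P2vPKPiOfTokensW1.pkPi_of_tokensW1 h80 hD7αTW1) (F0P2vE3FlatOfRelOne.e3flat_of_relOne (F0P2vRelOneOfRelSharpOne.relOne_of_relSharpOne hRS))`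
  — socket 27455 `F0HdictE` ⟸ {#80 `Rogawski1990.cohDiscrete_memXiFamily_archPinned` (LH1 leaf `F0_P3c_S2SharpPaydown`), D7αᵀ-W1 `F0P2oD7alphaMemDockStatementW1.StubD7αMemDockPerMeasureTW1`
  (PKΠ v1.16 «DOCK-TW1» node; closed as a TERM modulo LH10 `Db_T_paidW1` + closer `rung0Choice`, chair r379), REL♯¹ (the binder text of ★ `relOne_of_relSharpOne`, verbatim)};
* `H413_of_tokensW1 (h80) (hD7αTW1) (hRS) (hJ3a : HCCMUnconditional.F0HJ3a) : HCCMUnconditional.H413 :=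
    HCCMUnconditionalH413OfF0.H413_of_F0HdictE_F0HJ3a (hdictE_of_tokensW1 h80 hD7αTW1 hRS) hJ3a`.
Expected `#print axioms`: TRIO for both (the hypotheses are binders, not `sorry`s).  The T-variant pair (`pkPi_of_tokens`, node `StubD7αMemDockPerMeasureT`) is
superseded by W1 (chair r379) and not restated.

## References
* [Liu2021] Y. Liu, *Fourier–Jacobi cycles and arithmetic relative trace formula*, Camb. J. Math. 9 (2021): Prop. 4.13 (the crux H413 as printed).
* [Rogawski1990] J. D. Rogawski, *Automorphic Representations of Unitary Groups in Three Variables*, Ann. of Math. Stud. 123 (1990): §13.3 Thm. 13.3.6; §14.6.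
* [GelbartRogawski1991] S. Gelbart, J. Rogawski, *L-functions and Fourier–Jacobi coefficients for the unitary group U(3)*, Invent. Math. 105 (1991): §5.1 Lem. 5.1.2.
-/

set_option autoImplicit false
set_option linter.dupNamespace false

noncomputable section

-- the mandated namespace has the single-problem summit's repeated segment (`HodgeConjecture.HodgeConjecture`)
namespace Summit.HodgeConjecture.HodgeConjecture.Cruxes.H413.F0P2wEndgameOfTokensW1
open scoped Matrix ComplexOrder
open NumberField NumberField.InfinitePlace IsDedekindDomain MeasureTheory
open Literature.NumberTheory Literature.NumberTheory.Automorphic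
open Literature.NumberTheory.Automorphic.UnitaryGroup hiding transpose_map_cmConjRingHom_eq_of_frame
open Literature.NumberTheory.Automorphic.UnitaryGroup.CotangentForms
open Literature.NumberTheory.Automorphic.Liu2021 Literature.NumberTheory.Automorphic.Liu2021.AppendixC
open Literature.NumberTheory.Automorphic.Liu2021.Def411WeilCarriers
open Literature.NumberTheory.Automorphic.Liu2021.Def411WeilCarriersDoubling
open Literature.NumberTheory.Automorphic.IdeleClassGroup
open Literature.NumberTheory.GelbartRogawski1991 Literature.NumberTheory.GelbartRogawski1991.UnitaryDualPair
open Literature.NumberTheory.GelbartRogawski1991.UnitaryDualPair.WeilCoinv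
open Literature.RepresentationTheory Literature.RepresentationTheory.Liu2021
open Literature.NumberTheory.GaloisRepresentations
open Literature.NumberTheory.Rogawski1990
open Summit.HodgeConjecture.CorCM
open Summit.HodgeConjecture.CorCM.Transposition
open Summit.HodgeConjecture.HodgeConjecture.Cruxes.H413.F0P3MemXiFamilyTransfer
open Literature.NumberTheory.QuadraticForms
open Literature.AlgebraicGeometry.Liu2021 (IsAdmissibleElement exists_isAdmissibleElement_of_cmType)
open NumberField MeasureTheory IsDedekindDomain
open Literature.NumberTheory.Automorphic.Liu2021 Literature.NumberTheory.Automorphic.Liu2021.Def411WeilCarriers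
open Literature.RepresentationTheory.Liu2021
open Summit.HodgeConjecture.HodgeConjecture.Cruxes.H413.SpectrumInterfaces (oscillatorTriple_dictionaryExistence_holds_of)
open scoped TensorProduct
open NumberField.InfinitePlace
open Literature.RepresentationTheory
open Literature.NumberTheory.Automorphic.Liu2021.AppendixC
open HodgeCM.Model HodgeCM.Model.LiuIndex HodgeCM.Model.TowerCarrier
open Summit.HodgeConjecture.CorCM.Model
open Summit.HodgeConjecture.HodgeConjecture.Cruxes.H413.F0P3SLayerFoldShapes
open Summit.HodgeConjecture.HodgeConjecture.Cruxes.H413.F0P2cStubCLLocalTypeExists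
open Summit.HodgeConjecture.HodgeConjecture.Cruxes.H413.F0P2hLTYLocalConstituents
open Literature.RepresentationTheory.KonnoKonno2007 Literature.RepresentationTheory.BorelWallach2000   -- v1.4: `uFormGroup`, `upqTypeClasses` in `C2SharpLetter`
open Summit.HodgeConjecture.HodgeConjecture.Cruxes.H413.F0P2vRelOneOfRelSharpOne (relOne_of_relSharpOne)
open Summit.HodgeConjecture.HodgeConjecture.Cruxes.H413.F0P2vE3FlatOfRelOne (e3flat_of_relOne)
open Summit.HodgeConjecture.HodgeConjecture.Cruxes.H413.F0P2vPKPiOfTokensW1 (pkPi_of_tokensW1)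

set_option synthInstance.maxHeartbeats 400000 in
set_option maxHeartbeats 16000000 in
/-- **END-GAME (W1), socket level: `F0HdictE` (socket 27455, the P2 «Θ-dictionary» letter) from EXACTLY #80 S2♯ (`Rogawski1990.cohDiscrete_memXiFamily_archPinned`),
D7αᵀ-W1 (`F0P2oD7alphaMemDockStatementW1.StubD7αMemDockPerMeasureTW1`, the PKΠ v1.16 «DOCK-TW1» node) and REL♯¹ (the parity of the set of finite places where
two members of a `Ξ`-family differ in having a supercuspidal constituent — the binder text of ★ `relOne_of_relSharpOne`, verbatim)** — by composition of the ★ twins: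
`hdictE_of_PKPi_E3flat (pkPi_of_tokensW1 h80 hD7αTW1) (e3flat_of_relOne (relOne_of_relSharpOne hRS))`.  No new mathematics; value = one name for the registrar.
[cite: Liu2021, Prop. 4.13] [cite: Rogawski1990, §13.3 Thm. 13.3.6] [cite: GelbartRogawski1991, §5.1 Lem. 5.1.2] -/
theorem hdictE_of_tokensW1 (h80 : Literature.NumberTheory.Rogawski1990.cohDiscrete_memXiFamily_archPinned)
    (hD7αTW1 : Summit.HodgeConjecture.HodgeConjecture.Cruxes.H413.F0P2oD7alphaMemDockStatementW1.StubD7αMemDockPerMeasureTW1)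
    (hRS :
        ∀ (L : Type) [Field L] [NumberField L] [IsCMField L] (ι : L →+* ℂ) (H : Matrix (Fin 3) (Fin 3) L) (T : GL (Fin 3) ℂ)
          (hT : (T : Matrix (Fin 3) (Fin 3) ℂ)ᴴ * H.map ι * (T : Matrix (Fin 3) (Fin 3) ℂ) = Literature.Geometry.ComplexHyperbolic.BallModel.J),
          (∀ τ' : L →+* ℂ, InfinitePlace.mk τ' ≠ InfinitePlace.mk ι → (H.map τ').PosDef) → 2 ≤ Module.finrank ℚ ↥(maximalRealSubfield L) →
            ∀ (μA : Measure (adelicGroupData (↥(maximalRealSubfield L)) L (IsCMField.complexConj L) 3 H).automorphicQuotient)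
              [(adelicGroupData (↥(maximalRealSubfield L)) L (IsCMField.complexConj L) 3 H).IsAutomorphicMeasure μA]
              (P P' : DiscreteAutomorphicRep (adelicGroupData (↥(maximalRealSubfield L)) L (IsCMField.complexConj L) 3 H) μA),
              (P.IsHolCotangentAt (cmArchSection L ι H T hT) (cmCompactFactor L ι H T hT) ∨ P.IsAntiholCotangentAt (cmArchSection L ι H T hT) (cmCompactFactor L ι H T hT)) →
              (P'.IsHolCotangentAt (cmArchSection L ι H T hT) (cmCompactFactor L ι H T hT) ∨ P'.IsAntiholCotangentAt (cmArchSection L ι H T hT) (cmCompactFactor L ι H T hT)) →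
              ∀ (μω : HeckeCharacter L) (hμu : μω.IsUnitary),
                (∀ x : Literature.NumberTheory.GaloisRepresentations.ideleGroup ↥(maximalRealSubfield L),
                  μω (AdeleRing.ideleBaseChange (↥(maximalRealSubfield L)) L x) = quadraticHeckeCharCM L x) →
              ∀ (ξ : OneDimAutRepH L),
                MemXiFamily P (transpose_map_cmConjRingHom_eq_of_frame L ι H T hT) (isUnit_det_of_frame L ι H T hT) μω hμu ξ →
                MemXiFamily P' (transpose_map_cmConjRingHom_eq_of_frame L ι H T hT) (isUnit_det_of_frame L ι H T hT) μω hμu ξ →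
                  Even ({v : HeightOneSpectrum (𝓞 ↥(maximalRealSubfield L)) | ¬ ((∃ c : IrrClass ((cmDatum L 3 H).Local v),
                      (IrrClass.comap (localPiEquiv L (IsCMField.complexConj L) 3 H v) c).IsConstituentOf
                          (P.finRep.smoothPart.toRepresentation.comp (inclPlace (↥(maximalRealSubfield L)) L (IsCMField.complexConj L) 3 H v)) ∧
                        c.IsSupercuspidal) ↔
                    (∃ c : IrrClass ((cmDatum L 3 H).Local v),
                      (IrrClass.comap (localPiEquiv L (IsCMField.complexConj L) 3 H v) c).IsConstituentOf
                          (P'.finRep.smoothPart.toRepresentation.comp (inclPlace (↥(maximalRealSubfield L)) L (IsCMField.complexConj L) 3 H v)) ∧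
                        c.IsSupercuspidal))}.ncard)
    ) :
    Summit.HodgeConjecture.HodgeConjecture.Theses.HCCMUnconditional.F0HdictE :=
  Summit.HodgeConjecture.HodgeConjecture.Cruxes.H413.F0P2kHdictEOfLetters.hdictE_of_PKPi_E3flat (pkPi_of_tokensW1 h80 hD7αTW1) (e3flat_of_relOne (relOne_of_relSharpOne hRS))

set_option synthInstance.maxHeartbeats 400000 in
set_option maxHeartbeats 16000000 in
/-- **END-GAME (W1), crux level: `H413` ([Liu2021 Prop. 4.13] as the route reads it) from EXACTLY #80 S2♯, D7αᵀ-W1, REL♯¹ and socket 27456 `F0HJ3a`** —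
`H413_of_F0HdictE_F0HJ3a (hdictE_of_tokensW1 h80 hD7αTW1 hRS) hJ3a`.  This is the BY-NAME closing term for the registrar the day the three print inputs and
`F0HJ3a` are ★: `H413_of_tokensW1 h80 hD7αTW1 hRS hJ3a`.  No new mathematics.
[cite: Liu2021, Prop. 4.13] [cite: Rogawski1990, §13.3 Thm. 13.3.6] [cite: GelbartRogawski1991, §5.1 Lem. 5.1.2] -/
theorem H413_of_tokensW1 (h80 : Literature.NumberTheory.Rogawski1990.cohDiscrete_memXiFamily_archPinned)
    (hD7αTW1 : Summit.HodgeConjecture.HodgeConjecture.Cruxes.H413.F0P2oD7alphaMemDockStatementW1.StubD7αMemDockPerMeasureTW1)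
    (hRS :
        ∀ (L : Type) [Field L] [NumberField L] [IsCMField L] (ι : L →+* ℂ) (H : Matrix (Fin 3) (Fin 3) L) (T : GL (Fin 3) ℂ)
          (hT : (T : Matrix (Fin 3) (Fin 3) ℂ)ᴴ * H.map ι * (T : Matrix (Fin 3) (Fin 3) ℂ) = Literature.Geometry.ComplexHyperbolic.BallModel.J),
          (∀ τ' : L →+* ℂ, InfinitePlace.mk τ' ≠ InfinitePlace.mk ι → (H.map τ').PosDef) → 2 ≤ Module.finrank ℚ ↥(maximalRealSubfield L) →
            ∀ (μA : Measure (adelicGroupData (↥(maximalRealSubfield L)) L (IsCMField.complexConj L) 3 H).automorphicQuotient)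
              [(adelicGroupData (↥(maximalRealSubfield L)) L (IsCMField.complexConj L) 3 H).IsAutomorphicMeasure μA]
              (P P' : DiscreteAutomorphicRep (adelicGroupData (↥(maximalRealSubfield L)) L (IsCMField.complexConj L) 3 H) μA),
              (P.IsHolCotangentAt (cmArchSection L ι H T hT) (cmCompactFactor L ι H T hT) ∨ P.IsAntiholCotangentAt (cmArchSection L ι H T hT) (cmCompactFactor L ι H T hT)) →
              (P'.IsHolCotangentAt (cmArchSection L ι H T hT) (cmCompactFactor L ι H T hT) ∨ P'.IsAntiholCotangentAt (cmArchSection L ι H T hT) (cmCompactFactor L ι H T hT)) →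
              ∀ (μω : HeckeCharacter L) (hμu : μω.IsUnitary),
                (∀ x : Literature.NumberTheory.GaloisRepresentations.ideleGroup ↥(maximalRealSubfield L),
                  μω (AdeleRing.ideleBaseChange (↥(maximalRealSubfield L)) L x) = quadraticHeckeCharCM L x) →
              ∀ (ξ : OneDimAutRepH L),
                MemXiFamily P (transpose_map_cmConjRingHom_eq_of_frame L ι H T hT) (isUnit_det_of_frame L ι H T hT) μω hμu ξ →
                MemXiFamily P' (transpose_map_cmConjRingHom_eq_of_frame L ι H T hT) (isUnit_det_of_frame L ι H T hT) μω hμu ξ →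
                  Even ({v : HeightOneSpectrum (𝓞 ↥(maximalRealSubfield L)) | ¬ ((∃ c : IrrClass ((cmDatum L 3 H).Local v),
                      (IrrClass.comap (localPiEquiv L (IsCMField.complexConj L) 3 H v) c).IsConstituentOf
                          (P.finRep.smoothPart.toRepresentation.comp (inclPlace (↥(maximalRealSubfield L)) L (IsCMField.complexConj L) 3 H v)) ∧
                        c.IsSupercuspidal) ↔
                    (∃ c : IrrClass ((cmDatum L 3 H).Local v),
                      (IrrClass.comap (localPiEquiv L (IsCMField.complexConj L) 3 H v) c).IsConstituentOf
                          (P'.finRep.smoothPart.toRepresentation.comp (inclPlace (↥(maximalRealSubfield L)) L (IsCMField.complexConj L) 3 H v)) ∧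
                        c.IsSupercuspidal))}.ncard)
    )
    (hJ3a : Summit.HodgeConjecture.HodgeConjecture.Theses.HCCMUnconditional.F0HJ3a) :
    Summit.HodgeConjecture.HodgeConjecture.Theses.HCCMUnconditional.H413 :=
  Summit.HodgeConjecture.HodgeConjecture.Theorems.HCCMUnconditionalH413OfF0.H413_of_F0HdictE_F0HJ3a (hdictE_of_tokensW1 h80 hD7αTW1 hRS) hJ3a

end Summit.HodgeConjecture.HodgeConjecture.Cruxes.H413.F0P2wEndgameOfTokensW1

end
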